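import Literature.AlgebraicGeometry.Milne1999.CentraliserFixesDivisorClasses
import HarnessLib

/-!
# Moonen–Zarhin's group `G_div(X) = Gl_B(V) ∩ Sp(V, φ)` on the carrier, and «`G_div(X)` leaves invariant all
# divisor classes in `H²(X, ℚ) = ⋀²V`» (PROVED)

Layer `Literature/AlgebraicGeometry/HodgeTheory`; ONE definition cluster (`symmetricPullbackSpan`,
`divisorLefschetzGroup`) + theorems; no named fact (D-0026 net debt 0). Sequel of
`Milne1999/CentraliserFixesDivisorClasses` (Milne's `S(A)(ℂ) = unitaryCentralizerGroup A h` fixes the divisor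
classes), whose contraction argument is re-run for the LARGER group of Moonen–Zarhin.

## The print

B. J. J. Moonen, Yu. G. Zarhin, *Weil classes on abelian varieties*, J. reine angew. Math. **496** (1998) =
arXiv:alg-geom/9612017 [MoonenZarhin1998WeilClasses], §1 (held chunk p0002 L53–L76), VERBATIM: «Choose a
polarization `λ` of `X`, and write `α ↦ α†` for the associated Rosati involution of `End⁰(X) ≅ M_m(D)`. Let
`S_λ ⊆ End⁰(X)` be the set of `†`-symmetric elements. We define the algebra `B ⊆ End⁰(X)` as the `ℚ`-subalgebra
generated by `S_λ`. […] Let `φ = φ_X : V × V → ℚ` be the nondegenerate alternating bilinear form associated to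
`λ`. We define the algebraic group `G_div(X) ⊆ SP(V, φ)` as the centralizer of `B` in `SP(V, φ)`. More
precisely, `G_div(X) := Gl_B(V) ∩ SP(V, φ)`. Of course, the main motivation for introducing this group
`G_div(X)` is the fact that it is the largest algebraic subgroup of `Gl(V)` defined over `ℚ` which leaves
invariant all divisor classes in `H²(X, ℚ) = ⋀²V`. In fact, the divisor classes, viewed as alternating bilinear
forms on `V`, are precisely the forms `φ_s : (v₁, v₂) ↦ φ(s · v₁, v₂)` for `s ∈ S_λ`.»

## The carrier rendering (as in the lane's `Milne1999/LefschetzCentraliser`: `ℂ`-points, read on `H¹(A(ℂ); ℂ)`)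

* `V ⊗ ℂ = H¹(A(ℂ); ℂ)` with `End⁰(X) ⊗ ℂ` acting through the `ℂ`-span of the pull-backs `φ^*`
  (`VanGeemen1994.pullbackOne`); `φ ⊗ ℂ ∝ Q_h(x, y) = h^{dim A - 1} ∪ x ∪ y`
  (`Motives.polarizationPairingOne`) for the polarization CLASS `h`; the Rosati involution `†` = the
  `Q_h`-adjoint (Lange–Birkenhake §5.1), so
  **`S_λ ⊗ ℂ = symmetricPullbackSpan A h`** := the `Q_h`-self-adjoint elements of the span of the pull-backs
  (`†` is `ℚ`-linear, so the symmetric part of `End⁰(X) ⊗ ℂ` is `S_λ ⊗ ℂ`), and `B ⊗ ℂ` = the `ℂ`-subalgebra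
  it generates (`Algebra.adjoin`; commuting with `B ⊗ ℂ` is commuting with its generators,
  `divisorLefschetzGroup_comm_of_mem_adjoin`).
* **`G_div(X)(ℂ) = divisorLefschetzGroup A h`** := the automorphisms of `H¹(A(ℂ); ℂ)` commuting with every
  element of `S_λ ⊗ ℂ` and preserving `Q_h` — `Gl_B(V) ∩ Sp(V, φ)` on `ℂ`-points.
* Milne's `S(A)(h)(ℂ) = unitaryCentralizerGroup A h` (centralizer of ALL of `End⁰(X) ⊗ ℂ` in `Sp(Q_h)`) is a
  subgroup (`unitaryCentralizerGroup_le_divisorLefschetzGroup`), equal to `G_div(X)(ℂ)` as soon as `B ⊗ ℂ`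
  contains the pull-backs (`divisorLefschetzGroup_eq_unitaryCentralizerGroup_of_forall_mem_adjoin`; e.g. when
  every pull-back is `Q_h`-self-adjoint, `…_of_forall_isSelfAdjoint` — the print's «`B = End⁰(X)`» cases are
  «`m ≥ 2` or type 1 or 2» and type 4 with `d ≥ 2`, by Table 1, NOT derived here), and
  `Hg(A)(ℂ)|_{H¹} ≤ S(A)(h)(ℂ) ≤ G_div(X)(ℂ)` for `h ∈ B¹(A) ⊗ ℂ`.

## What is proved — «`G_div(X)` leaves invariant all divisor classes in `H²(X, ℚ) = ⋀²V`»

For `dim A ≥ 1`, `h ∈ B¹(A) ⊗ ℂ` with `Q_h` non-degenerate (in particular for a polarization class: rational,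
type `(1,1)`, hard Lefschetz), `u ∈ divisorLefschetzGroup A h` and a rational `(1,1)`-class
`c = Σ_l a_l x_l ∪ y_l ∈ H²(A(ℂ); ℂ)`:
* **`apply_contraction_eq_of_mem_divisorLefschetzGroup`** — `u w_c(μ ∘ u) = w_c(μ)` for the contraction
  vectors `w_c(μ) = Σ_l a_l (μ(y_l) x_l - μ(x_l) y_l)`. The tree's argument for `S(A)` (Milne Thm. 4.4 via
  Deligne I 3.4: `T_c = W_c ∘ Q♭_h` commutes with `Hg(A)(ℂ)`, hence is a `ℂ`-combination of pull-backs) is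
  completed by ONE new observation, which is exactly the print's «the divisor classes … are precisely the
  forms `φ_s`, `s ∈ S_λ`»: **`T_c` is `Q_h`-self-adjoint** (`Q_h(T_c z, z') = Q_h(z, T_c z')`, both `Q_h` and
  the `2`-vector being alternating), so `T_c ∈ S_λ ⊗ ℂ` and every `u ∈ G_div(X)(ℂ)` commutes with it.
* **`exteriorPullback_two_eq_self_of_mem_divisorLefschetzGroup`** — `⋀²u c = c`;
  **`exteriorPullback_eq_self_of_mem_divisorClassesSpan_of_mem_divisorLefschetzGroup`** — `⋀^{2p}u` fixes
  `D^p(A) ⊗ ℂ = divisorClassesSpan A.X (dim A) p` (Lemma (3) «`(⊕ᵢ ⋀ⁱ V_X)^{G_div(X)} ⊇ 𝒟^•(X)`», the easy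
  inclusion); `det u = 1` when `h^{dim A} ≠ 0` (`det_eq_one_of_mem_divisorLefschetzGroup`); and the
  polarization-class spelling. Milne's theorems for `S(A)(h)(ℂ)` (the tree's
  `Milne1999.exteriorPullback_eq_self_of_mem_divisorClassesSpan_of_nondegenerate`, not restated) are the
  special case `S ≤ G_div` (`unitaryCentralizerGroup_le_divisorLefschetzGroup`).

* Part 3, the inclusions of Lemma (3) «`End(V_X)^{G_div(X)} = B`» and Lemma (1) «`Z(G_div(X)) = U_{K_B}`»
  that hold on the carrier: `B ⊗ ℂ ⊆ End(V)^{G_div(X)(ℂ)} ⊆ End⁰(X) ⊗ ℂ`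
  (`divisorLefschetzGroup_comm_of_mem_adjoin`, `mem_span_pullbackOne_of_forall_mem_divisorLefschetzGroup_comm`),
  `U_{K_B} ⊆ Z(G_div(X)(ℂ))` (`mem_center_divisorLefschetzGroup_of_coe_mem_adjoin`) and
  `Z(G_div(X)(ℂ)) ⊆ End⁰(X) ⊗ ℂ` (`coe_mem_span_pullbackOne_of_mem_center_divisorLefschetzGroup`); the two
  equalities need the double commutant theorem for `B ⊗ ℂ ⊆ End(V)` and are NOT here.

NOT here: «largest» (the converse: an automorphism fixing all divisor classes lies in `G_div` — it needs the
surjectivity `B¹(A) ⊗ ℂ → S_λ ⊗ ℂ`, `c ↦ T_c`, of the Néron–Severi dictionary, absent on this carrier);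
Lemma (3) `=`; Table 1 (`B`, `K_B` by Albert type); `G_div` as an algebraic group over `ℚ`, connectedness.

## References

* [MoonenZarhin1998WeilClasses] B. J. J. Moonen, Yu. G. Zarhin, J. reine angew. Math. 496 (1998) =
  arXiv:alg-geom/9612017, §1 (definition of `B`, `G_div(X)`; chunk p0002 L53–L76), Lemma (1), Lemma (3)
  (chunks p0002–p0003).
* [Milne1999LefschetzClasses] J. S. Milne, Duke Math. J. 96 (1999), §1 pp. 642–644, Thm. 4.4 (p. 659).
* [Deligne1982HodgeCycles] P. Deligne, LNM 900 (1982), I Prop. 3.4, proof of Prop. 5.1.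
* [LangeBirkenhake1992] H. Lange, Ch. Birkenhake, *Complex Abelian Varieties*, §5.1 (Rosati = adjoint),
  Lemma 1.1.17 (`H• = ⋀•H¹`).
* [HatcherAT2002] A. Hatcher, *Algebraic Topology*, §3.2 Thm. 3.11 (graded commutativity).

## Provenance

Lane `lit-hodgefound` (Track 2, Layer A), prover seat `lit-hodgefound-p21` (generation 13), row g13-#6: the
reading caveat of the seat's `LefschetzGroup*` files («`G_div` read as Milne's `S(A)(h)`») made into
mathematics — the print's own group, with Milne's group as a subgroup.
-/

noncomputable section

open CategoryTheory
open Literature.AlgebraicTopology.SingularHomology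
open Literature.AlgebraicGeometry.Motives
open Literature.AlgebraicGeometry.VanGeemen1994 (pullbackOne hodgeGroupOne mem_hodgeGroupOne_iff hodgeClassSpan)
open Literature.AlgebraicGeometry.Milne1999 (centralizerGroup unitaryCentralizerGroup mem_centralizerGroup_iff
  hodgeGroupOne_le_unitaryCentralizerGroup apply_one_contraction_eq_of_mem_hodgeGroup)
open Literature.Barriers.HodgeConjecture (divisorClassesSpan divisorMonomials mem_divisorMonomials_zero
  mem_divisorMonomials_succ)
open Literature.Geometry.Kaehler (HasHardLefschetzProperty)

namespace Literature.AlgebraicGeometry.HodgeTheory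

variable (A : AbelianVariety ℂ) (h : complexBetti A.X 2)

/-! ## Part 1. The definitions: `S_λ ⊗ ℂ` and `G_div(X)(ℂ)` on `H¹(A(ℂ); ℂ)` -/

/-- **`S_λ ⊗ ℂ` — the `†`-symmetric elements of `End⁰(X) ⊗ ℂ`, on the carrier**: the `ℂ`-combinations `T`
of pull-backs `φ^*` (`φ ∈ End(A)`) which are self-adjoint for the polarization pairing,
`Q_h(T x, y) = Q_h(x, T y)` («`S_λ ⊆ End⁰(X)` … the set of `†`-symmetric elements», the Rosati involution
read as the `Q_h`-adjoint). A `ℂ`-subspace of `End(H¹(A(ℂ); ℂ))`.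
[cite: MoonenZarhin1998WeilClasses, §1 (definition of S_λ and B; chunk p0002)] [cite: LangeBirkenhake1992, §5.1] -/
def symmetricPullbackSpan : Submodule ℂ (Module.End ℂ (complexBetti A.X 1)) where
  carrier := {T | T ∈ Submodule.span ℂ (Set.range fun φ : A ⟶ A ↦ pullbackOne A φ) ∧
    ∀ x y : complexBetti A.X 1, polarizationPairingOne A.X h (A.dim - 1) (T x) y =
      polarizationPairingOne A.X h (A.dim - 1) x (T y)}
  add_mem' := by
    rintro T T' ⟨hT, hTs⟩ ⟨hT', hT's⟩
    refine ⟨Submodule.add_mem _ hT hT', fun x y ↦ ?_⟩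
    rw [LinearMap.add_apply, LinearMap.add_apply, map_add, LinearMap.add_apply, map_add, hTs, hT's]
  zero_mem' := ⟨Submodule.zero_mem _, fun x y ↦ by simp⟩
  smul_mem' := by
    rintro a T ⟨hT, hTs⟩
    refine ⟨Submodule.smul_mem _ a hT, fun x y ↦ ?_⟩
    rw [LinearMap.smul_apply, LinearMap.smul_apply, map_smul, LinearMap.smul_apply, map_smul, hTs]

/-- **`G_div(X)(ℂ) := Gl_B(V) ∩ Sp(V, φ)` on the carrier** — «the centralizer of `B` in `SP(V, φ)`», `B`
the subalgebra generated by the `†`-symmetric elements: the automorphisms of `H¹(A(ℂ); ℂ)` commuting with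
every element of `S_λ ⊗ ℂ = symmetricPullbackSpan A h` (equivalently with the algebra `B ⊗ ℂ` it generates,
`divisorLefschetzGroup_comm_of_mem_adjoin`) and preserving `Q_h`. (It is indexed by the class `h`, as
Milne's `unitaryCentralizerGroup A h`; the print's «does not depend on the choice of `λ`» is not formalised.)
[cite: MoonenZarhin1998WeilClasses, §1 (definition of G_div(X); chunk p0002)] -/
def divisorLefschetzGroup : Subgroup (complexBetti A.X 1 ≃ₗ[ℂ] complexBetti A.X 1) where
  carrier := {u | (∀ T ∈ symmetricPullbackSpan A h, ∀ x : complexBetti A.X 1, u (T x) = T (u x)) ∧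
    ∀ x y : complexBetti A.X 1, polarizationPairingOne A.X h (A.dim - 1) (u x) (u y) =
      polarizationPairingOne A.X h (A.dim - 1) x y}
  mul_mem' := by
    rintro u v ⟨hu, hu'⟩ ⟨hv, hv'⟩
    refine ⟨fun T hT x ↦ ?_, fun x y ↦ ?_⟩
    · rw [LinearEquiv.mul_apply, LinearEquiv.mul_apply, hv T hT, hu T hT]
    · rw [LinearEquiv.mul_apply, LinearEquiv.mul_apply, hu', hv']
  one_mem' := ⟨fun _ _ _ ↦ rfl, fun _ _ ↦ rfl⟩
  inv_mem' := by
    rintro u ⟨hu, hu'⟩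
    refine ⟨fun T hT x ↦ ?_, fun x y ↦ ?_⟩
    · rw [LinearEquiv.coe_inv, LinearEquiv.symm_apply_eq, hu T hT, LinearEquiv.apply_symm_apply]
    · rw [← hu' (u⁻¹ x) (u⁻¹ y), LinearEquiv.coe_inv, LinearEquiv.apply_symm_apply,
        LinearEquiv.apply_symm_apply]

variable {A h} {u : complexBetti A.X 1 ≃ₗ[ℂ] complexBetti A.X 1} {T : Module.End ℂ (complexBetti A.X 1)}

/-- Membership in `S_λ ⊗ ℂ`, unfolded. [cite: MoonenZarhin1998WeilClasses, §1 (chunk p0002)] -/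
theorem mem_symmetricPullbackSpan_iff :
    T ∈ symmetricPullbackSpan A h ↔ T ∈ Submodule.span ℂ (Set.range fun φ : A ⟶ A ↦ pullbackOne A φ) ∧
      ∀ x y : complexBetti A.X 1, polarizationPairingOne A.X h (A.dim - 1) (T x) y =
        polarizationPairingOne A.X h (A.dim - 1) x (T y) :=
  Iff.rfl

/-- Membership in `G_div(X)(ℂ)`, unfolded. [cite: MoonenZarhin1998WeilClasses, §1 (chunk p0002)] -/
theorem mem_divisorLefschetzGroup_iff :
    u ∈ divisorLefschetzGroup A h ↔
      (∀ T ∈ symmetricPullbackSpan A h, ∀ x : complexBetti A.X 1, u (T x) = T (u x)) ∧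
      ∀ x y : complexBetti A.X 1, polarizationPairingOne A.X h (A.dim - 1) (u x) (u y) =
        polarizationPairingOne A.X h (A.dim - 1) x y :=
  Iff.rfl

/-- `S_λ ⊗ ℂ ⊆ End⁰(X) ⊗ ℂ` (the span of the pull-backs). [cite: MoonenZarhin1998WeilClasses, §1 (chunk p0002)] -/
theorem symmetricPullbackSpan_le_span :
    symmetricPullbackSpan A h ≤ Submodule.span ℂ (Set.range fun φ : A ⟶ A ↦ pullbackOne A φ) :=
  fun _ hT ↦ hT.1

/-- An automorphism commuting with every pull-back commutes with their `ℂ`-combinations. [folklore] -/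
private theorem comm_of_mem_span (hu : u ∈ centralizerGroup A)
    (hT : T ∈ Submodule.span ℂ (Set.range fun φ : A ⟶ A ↦ pullbackOne A φ)) (x : complexBetti A.X 1) :
    u (T x) = T (u x) := by
  induction hT using Submodule.span_induction generalizing x with
  | mem S hS =>
    obtain ⟨φ, rfl⟩ := hS
    exact (mem_centralizerGroup_iff.1 hu) φ x
  | zero => simp
  | add S S' _ _ hS hS' => rw [LinearMap.add_apply, LinearMap.add_apply, map_add, hS, hS']
  | smul r S _ hS => rw [LinearMap.smul_apply, LinearMap.smul_apply, map_smul, hS]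

/-- **`S(A)(h)(ℂ) ≤ G_div(X)(ℂ)`**: Milne's group (the centralizer of all of `End⁰(X) ⊗ ℂ` in `Sp(Q_h)`) is
contained in Moonen–Zarhin's (the centralizer of `B ⊗ ℂ ⊆ End⁰(X) ⊗ ℂ`).
[cite: MoonenZarhin1998WeilClasses, §1 (chunk p0002)] [cite: Milne1999LefschetzClasses, §1 p. 644] -/
theorem unitaryCentralizerGroup_le_divisorLefschetzGroup :
    unitaryCentralizerGroup A h ≤ divisorLefschetzGroup A h :=
  fun _ hu ↦ ⟨fun _ hT x ↦ comm_of_mem_span hu.1 hT.1 x, hu.2⟩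

/-- **`Hg(A)(ℂ)|_{H¹} ≤ G_div(X)(ℂ)`** for `h ∈ B¹(A) ⊗ ℂ` (through `Hg(A)(ℂ)|_{H¹} ≤ S(A)(h)(ℂ)`).
[cite: MoonenZarhin1998WeilClasses, §1 (chunk p0002)] [cite: Milne1999LefschetzClasses, Prop. 4.8 (p. 660)] -/
theorem hodgeGroupOne_le_divisorLefschetzGroup (hh : h ∈ hodgeClassSpan A.dim A.X 1) :
    hodgeGroupOne A.dim A.X ≤ divisorLefschetzGroup A h :=
  (hodgeGroupOne_le_unitaryCentralizerGroup hh).trans unitaryCentralizerGroup_le_divisorLefschetzGroup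

/-- **`G_div(X)(ℂ)` commutes with `B ⊗ ℂ`**, the `ℂ`-subalgebra of `End(H¹(A(ℂ); ℂ))` generated by
`S_λ ⊗ ℂ` («the `ℚ`-subalgebra generated by `S_λ`»; centralizing the generators is centralizing the algebra).
[cite: MoonenZarhin1998WeilClasses, §1 (definition of B; chunk p0002)] -/
theorem divisorLefschetzGroup_comm_of_mem_adjoin (hu : u ∈ divisorLefschetzGroup A h)
    (hT : T ∈ Algebra.adjoin ℂ (symmetricPullbackSpan A h : Set (Module.End ℂ (complexBetti A.X 1))))
    (x : complexBetti A.X 1) : u (T x) = T (u x) := by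
  induction hT using Algebra.adjoin_induction generalizing x with
  | mem S hS => exact hu.1 S hS x
  | algebraMap r => simp
  | add S S' _ _ hS hS' => rw [LinearMap.add_apply, LinearMap.add_apply, map_add, hS, hS']
  | mul S S' _ _ hS hS' => rw [Module.End.mul_apply, Module.End.mul_apply, hS, hS']

/-- **`G_div(X)(ℂ) = S(A)(h)(ℂ)` when `B ⊗ ℂ` contains the pull-backs** (the print's «`B = End⁰(X)`»):
if every `φ^*` lies in the subalgebra generated by `S_λ ⊗ ℂ`, the two groups coincide.
[cite: MoonenZarhin1998WeilClasses, §1 («if m ≥ 2 or if X is of type 1 or 2, then … Δ = D»; chunk p0002)] -/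
theorem divisorLefschetzGroup_eq_unitaryCentralizerGroup_of_forall_mem_adjoin
    (hB : ∀ φ : A ⟶ A, pullbackOne A φ ∈
      Algebra.adjoin ℂ (symmetricPullbackSpan A h : Set (Module.End ℂ (complexBetti A.X 1)))) :
    divisorLefschetzGroup A h = unitaryCentralizerGroup A h := by
  refine le_antisymm (fun u hu ↦ ⟨?_, hu.2⟩) unitaryCentralizerGroup_le_divisorLefschetzGroup
  exact mem_centralizerGroup_iff.2 fun φ x ↦ divisorLefschetzGroup_comm_of_mem_adjoin hu (hB φ) x

/-- **`G_div(X)(ℂ) = S(A)(h)(ℂ)` when the Rosati involution is trivial on `End⁰(X)`** (every pull-back is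
`Q_h`-self-adjoint, so `S_λ ⊗ ℂ = End⁰(X) ⊗ ℂ = B ⊗ ℂ`; e.g. type I with `m = 1`).
[cite: MoonenZarhin1998WeilClasses, §1 (chunk p0002)] [cite: Milne1999LefschetzClasses, §2 p. 645 («Type I: … the Rosati involutions are trivial»)] -/
theorem divisorLefschetzGroup_eq_unitaryCentralizerGroup_of_forall_isSelfAdjoint
    (hsa : ∀ (φ : A ⟶ A) (x y : complexBetti A.X 1),
      polarizationPairingOne A.X h (A.dim - 1) (pullbackOne A φ x) y =
        polarizationPairingOne A.X h (A.dim - 1) x (pullbackOne A φ y)) :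
    divisorLefschetzGroup A h = unitaryCentralizerGroup A h :=
  divisorLefschetzGroup_eq_unitaryCentralizerGroup_of_forall_mem_adjoin fun φ ↦
    Algebra.subset_adjoin ⟨Submodule.subset_span ⟨φ, rfl⟩, hsa φ⟩

/-! ## Part 2. `G_div(X)(ℂ)` fixes the divisor classes -/

section Contraction

variable {ι : Type} [Fintype ι] {κ : Type*} [Fintype κ]

/-- `Q_h(y, x) = -Q_h(x, y)` in degree one (graded commutativity). [cite: HatcherAT2002, §3.2 Thm. 3.11] -/
private theorem Q_swap (x y : complexBetti A.X 1) :
    polarizationPairingOne A.X h (A.dim - 1) y x = -polarizationPairingOne A.X h (A.dim - 1) x y := by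
  rw [Motives.polarizationPairingOne_apply, Motives.polarizationPairingOne_apply,
    cupProduct_gradedComm_holds (R := ℂ) (X := ComplexPoints A.X) rfl rfl y x, map_smul, pow_one,
    neg_one_smul]

/-- `2 · x ∪ y = Σ_i (β_i(y) x - β_i(x) y) ∪ b_i` for a basis `b` with coordinates `β_i`.
[cite: HatcherAT2002, §3.2 Thm. 3.11] -/
private theorem two_smul_cupProduct_eq_sum_basis (b : Module.Basis κ ℂ (complexBetti A.X 1))
    (x y : complexBetti A.X 1) :
    (2 : ℂ) • cupProduct (rfl : 1 + 1 = 2) x y =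
      ∑ i, cupProduct (rfl : 1 + 1 = 2) (b.coord i y • x - b.coord i x • y) (b i) := by
  have expand : ∀ v w : complexBetti A.X 1,
      ∑ i, cupProduct (rfl : 1 + 1 = 2) (b.coord i w • v) (b i) = cupProduct (rfl : 1 + 1 = 2) v w := by
    intro v w
    calc ∑ i, cupProduct (rfl : 1 + 1 = 2) (b.coord i w • v) (b i)
        = ∑ i, cupProduct (rfl : 1 + 1 = 2) v (b.coord i w • b i) := by
          refine Finset.sum_congr rfl fun i _ ↦ ?_
          rw [map_smul, LinearMap.smul_apply, map_smul]
      _ = cupProduct (rfl : 1 + 1 = 2) v (∑ i, b.coord i w • b i) := by rw [map_sum]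
      _ = cupProduct (rfl : 1 + 1 = 2) v w := by simp_rw [Module.Basis.coord_apply, Module.Basis.sum_repr]
  simp only [map_sub, LinearMap.sub_apply, Finset.sum_sub_distrib, expand]
  rw [cupProduct_gradedComm_holds ℂ (ComplexPoints A.X) (rfl : 1 + 1 = 2) rfl y x, two_smul, mul_one,
    pow_one, neg_one_smul, sub_neg_eq_add]

/-- `2c = Σ_i w_c(β_i) ∪ b_i` for a `2`-vector `c = Σ_l a_l x_l ∪ y_l`. [cite: HatcherAT2002, §3.2 Thm. 3.11] -/
private theorem two_smul_sum_smul_cupProduct_eq_sum_basis (b : Module.Basis κ ℂ (complexBetti A.X 1))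
    (a : ι → ℂ) (x y : ι → complexBetti A.X 1) :
    (2 : ℂ) • ∑ l, a l • cupProduct (rfl : 1 + 1 = 2) (x l) (y l) =
      ∑ i, cupProduct (rfl : 1 + 1 = 2)
        (∑ l, a l • (b.coord i (y l) • x l - b.coord i (x l) • y l)) (b i) := by
  calc (2 : ℂ) • ∑ l, a l • cupProduct (rfl : 1 + 1 = 2) (x l) (y l)
      = ∑ l, a l • ((2 : ℂ) • cupProduct (rfl : 1 + 1 = 2) (x l) (y l)) := by
        rw [Finset.smul_sum]
        exact Finset.sum_congr rfl fun l _ ↦ smul_comm _ _ _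
    _ = ∑ l, ∑ i, a l • cupProduct (rfl : 1 + 1 = 2)
          (b.coord i (y l) • x l - b.coord i (x l) • y l) (b i) := by
        simp_rw [two_smul_cupProduct_eq_sum_basis b, Finset.smul_sum]
    _ = ∑ i, ∑ l, a l • cupProduct (rfl : 1 + 1 = 2)
          (b.coord i (y l) • x l - b.coord i (x l) • y l) (b i) := Finset.sum_comm
    _ = ∑ i, cupProduct (rfl : 1 + 1 = 2)
          (∑ l, a l • (b.coord i (y l) • x l - b.coord i (x l) • y l)) (b i) := by
        simp_rw [map_sum, map_smul, LinearMap.sum_apply, LinearMap.smul_apply]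

/-- Equivariance of the contraction vectors forces invariance of the `2`-vector.
[cite: HatcherAT2002, §3.2 Thm. 3.11] [cite: LangeBirkenhake1992, Lemma 1.1.17] -/
private theorem sum_smul_cupProduct_apply_apply_eq_of_forall_dual
    (u : complexBetti A.X 1 ≃ₗ[ℂ] complexBetti A.X 1) (a : ι → ℂ) (x y : ι → complexBetti A.X 1)
    (H : ∀ μ : Module.Dual ℂ (complexBetti A.X 1),
      u (∑ l, a l • (μ (u (y l)) • x l - μ (u (x l)) • y l)) =
        ∑ l, a l • (μ (y l) • x l - μ (x l) • y l)) :
    ∑ l, a l • cupProduct (rfl : 1 + 1 = 2) (u (x l)) (u (y l)) =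
      ∑ l, a l • cupProduct (rfl : 1 + 1 = 2) (x l) (y l) := by
  haveI : Module.Finite ℂ (complexBetti A.X 1) := abelianVarietyCohomologyExteriorH1_holds.finite_one A
  let b := Module.finBasis ℂ (complexBetti A.X 1)
  have hlin : ∀ μ : Module.Dual ℂ (complexBetti A.X 1),
      ∑ l, a l • (μ (u (y l)) • u (x l) - μ (u (x l)) • u (y l)) =
        u (∑ l, a l • (μ (u (y l)) • x l - μ (u (x l)) • y l)) := by
    intro μ
    simp only [map_sum, map_smul, map_sub]
  have e : (2 : ℂ) • ∑ l, a l • cupProduct (rfl : 1 + 1 = 2) (u (x l)) (u (y l)) =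
      (2 : ℂ) • ∑ l, a l • cupProduct (rfl : 1 + 1 = 2) (x l) (y l) := by
    rw [two_smul_sum_smul_cupProduct_eq_sum_basis b a (fun l ↦ u (x l)) (fun l ↦ u (y l)),
      two_smul_sum_smul_cupProduct_eq_sum_basis b a x y]
    refine Finset.sum_congr rfl fun i _ ↦ ?_
    rw [hlin (b.coord i), H (b.coord i)]
  exact smul_right_injective _ (two_ne_zero (α := ℂ)) e

/-- **`G_div(X)(ℂ)` moves the contraction vectors of every rational `(1,1)`-class equivariantly.** For
`dim A ≥ 1`, `h ∈ B¹(A) ⊗ ℂ` with `Q_h` non-degenerate, `u ∈ divisorLefschetzGroup A h`, a rational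
`(1,1)`-class `c = Σ_l a_l x_l ∪ y_l` and every functional `μ`: `u w_c(μ ∘ u) = w_c(μ)`.
Proof: as for `S(A)` (`Milne1999.apply_contraction_eq_of_mem_unitaryCentralizerGroup_of_nondegenerate`:
`T_c = W_c ∘ Q♭_h` commutes with `Hg(A)(ℂ)|_{H¹}`, hence is a `ℂ`-combination of pull-backs, Deligne I 3.4)
plus: **`T_c` is `Q_h`-self-adjoint** (`Q_h` and the `2`-vector are alternating) — the print's «the divisor
classes, viewed as alternating bilinear forms on `V`, are precisely the forms `φ_s`, `s ∈ S_λ`» — so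
`T_c ∈ S_λ ⊗ ℂ` and `u` commutes with `T_c`; unwind with `Q♭(u z) = Q♭(z) ∘ u⁻¹`.
[cite: MoonenZarhin1998WeilClasses, §1 («leaves invariant all divisor classes … φ_s for s ∈ S_λ»; chunk p0002)]
[cite: Milne1999LefschetzClasses, Thm. 4.4 (proof, p. 659)] [cite: Deligne1982HodgeCycles, I §3 Prop. 3.4, §5 Prop. 5.1 (proof)] -/
theorem apply_contraction_eq_of_mem_divisorLefschetzGroup (hn : 1 ≤ A.dim)
    (hh : h ∈ hodgeClassSpan A.dim A.X 1)
    (hnd : ∀ x : complexBetti A.X 1, (∀ y, polarizationPairingOne A.X h (A.dim - 1) x y = 0) → x = 0)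
    (hu : u ∈ divisorLefschetzGroup A h)
    {c : complexBetti A.X 2} (hcQ : IsRationalClass c) (hc11 : IsOfHodgeType A.dim A.X 2 1 1 c)
    (a : ι → ℂ) (x y : ι → complexBetti A.X 1)
    (hc : c = ∑ l, a l • cupProduct (rfl : 1 + 1 = 2) (x l) (y l))
    (μ : Module.Dual ℂ (complexBetti A.X 1)) :
    u (∑ l, a l • (μ (u (y l)) • x l - μ (u (x l)) • y l)) =
      ∑ l, a l • (μ (y l) • x l - μ (x l) • y l) := by
  classical
  haveI : Module.Finite ℂ (complexBetti A.X 1) := abelianVarietyCohomologyExteriorH1_holds.finite_one A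
  haveI : Module.Finite ℂ (complexBetti A.X (2 + 2 * (A.dim - 1))) :=
    abelianVarietyCohomologyExteriorH1_holds.finite A _
  set Q := polarizationPairingOne A.X h (A.dim - 1) with hQdef
  -- the contraction map `W = W_c : (H¹)^∨ → H¹`
  let W : Module.Dual ℂ (complexBetti A.X 1) →ₗ[ℂ] complexBetti A.X 1 :=
    ∑ l, a l • ((Module.Dual.eval ℂ (complexBetti A.X 1) (y l)).smulRight (x l) -
      (Module.Dual.eval ℂ (complexBetti A.X 1) (x l)).smulRight (y l))
  have hW : ∀ lam, W lam = ∑ l, a l • (lam (y l) • x l - lam (x l) • y l) := by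
    intro lam
    simp only [W, LinearMap.sum_apply, LinearMap.smul_apply, LinearMap.sub_apply,
      LinearMap.smulRight_apply, Module.Dual.eval_apply]
  -- (1) Hodge-group equivariance of `W`
  have hHg : ∀ g ∈ hodgeGroup A.dim A.X, ∀ lam : Module.Dual ℂ (complexBetti A.X 1),
      g 1 (W (lam.comp (g 1 : complexBetti A.X 1 →ₗ[ℂ] complexBetti A.X 1))) = W lam := by
    intro g hg lam
    rw [hW, hW]
    simp only [LinearMap.comp_apply, LinearEquiv.coe_coe]
    exact apply_one_contraction_eq_of_mem_hodgeGroup hn hcQ hc11 a x y hc hg lam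
  -- (2) `Q♭ : H¹ → (H¹)^∨` through a trivialisation `τ` of the top line
  have h1 : Module.finrank ℂ (complexBetti A.X (2 + 2 * (A.dim - 1))) = Module.finrank ℂ ℂ := by
    rw [Module.finrank_self, abelianVarietyCohomologyExteriorH1_holds.finrank_eq,
      show 2 + 2 * (A.dim - 1) = 2 * A.dim by omega, Nat.choose_self]
  let τ : complexBetti A.X (2 + 2 * (A.dim - 1)) ≃ₗ[ℂ] ℂ := LinearEquiv.ofFinrankEq _ _ h1
  let Qf : complexBetti A.X 1 →ₗ[ℂ] Module.Dual ℂ (complexBetti A.X 1) := Q.compr₂ τ.toLinearMap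
  have hQf : ∀ v w, Qf v w = τ (Q v w) := fun v w ↦ rfl
  have hQf_inj : Function.Injective Qf := by
    rw [← LinearMap.ker_eq_bot, LinearMap.ker_eq_bot']
    intro v hv
    refine hnd v fun w ↦ ?_
    have e := LinearMap.congr_fun hv w
    rwa [hQf, LinearMap.zero_apply, map_eq_zero_iff _ τ.injective] at e
  have hQf_surj : Function.Surjective Qf :=
    (LinearMap.injective_iff_surjective_of_finrank_eq_finrank Subspace.dual_finrank_eq.symm).1 hQf_inj
  have hQf_iso : ∀ e : complexBetti A.X 1 ≃ₗ[ℂ] complexBetti A.X 1,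
      (∀ v w, Q (e v) (e w) = Q v w) →
      ∀ v, Qf (e v) = (Qf v).comp (e.symm : complexBetti A.X 1 →ₗ[ℂ] complexBetti A.X 1) := by
    intro e he v
    ext w
    rw [LinearMap.comp_apply, hQf, hQf, LinearEquiv.coe_coe]
    congr 1
    conv_lhs => rw [← e.apply_symm_apply w]
    exact he v (e.symm w)
  -- (3) `T = W ∘ Q♭` commutes with the Hodge group, hence lies in the span of the `φ^*`
  have hT : ∀ g ∈ hodgeGroup A.dim A.X, ∀ z : complexBetti A.X 1,
      (W.comp Qf) (g 1 z) = g 1 ((W.comp Qf) z) := by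
    intro g hg z
    have hgQ : ∀ v w, Q (g 1 v) (g 1 w) = Q v w :=
      (hodgeGroupOne_le_unitaryCentralizerGroup hh (mem_hodgeGroupOne_iff.2 ⟨g, hg, rfl⟩)).2
    have hcomp : ((Qf z).comp ((g 1).symm : complexBetti A.X 1 →ₗ[ℂ] complexBetti A.X 1)).comp
        (g 1 : complexBetti A.X 1 →ₗ[ℂ] complexBetti A.X 1) = Qf z := by
      ext v
      simp
    rw [LinearMap.comp_apply, LinearMap.comp_apply, hQf_iso (g 1) hgQ z]
    conv_rhs => rw [← hcomp]
    exact (hHg g hg _).symm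
  have hTspan : W.comp Qf ∈ Submodule.span ℂ (Set.range fun φ : A ⟶ A ↦ pullbackOne A φ) :=
    Deligne1982.mem_span_complexBetti_map_of_commute_hodgeGroup_of_riemann deligneMilne1982_Thm_6_20_full_holds A
      (W.comp Qf) hT
  -- (3') NEW: `T` is `Q_h`-self-adjoint, hence lies in `S_λ ⊗ ℂ`
  have Q_swap' : ∀ v w : complexBetti A.X 1, Q w v = -Q v w := fun v w ↦ Q_swap v w
  have hTz : ∀ z, (W.comp Qf) z = ∑ l, a l • (Qf z (y l) • x l - Qf z (x l) • y l) := fun z ↦ by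
    rw [LinearMap.comp_apply, hW]
  have hTsa : ∀ z z', Q ((W.comp Qf) z) z' = Q z ((W.comp Qf) z') := by
    intro z z'
    apply τ.injective
    rw [hTz, hTz, map_sum, LinearMap.sum_apply, map_sum, map_sum, map_sum]
    refine Finset.sum_congr rfl fun l _ ↦ ?_
    simp only [map_smul, map_sub, LinearMap.smul_apply, LinearMap.sub_apply, smul_eq_mul, hQf,
      Q_swap' z' (x l), Q_swap' z' (y l), map_neg]
    ring
  have hTS : W.comp Qf ∈ symmetricPullbackSpan A h := ⟨hTspan, hTsa⟩
  -- (4) `u` commutes with `T`; unwind with `Q♭ (u z) = Q♭ z ∘ u⁻¹` and the surjectivity of `Q♭`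
  obtain ⟨z, hz⟩ := hQf_surj (μ.comp (u : complexBetti A.X 1 →ₗ[ℂ] complexBetti A.X 1))
  have e1 := hu.1 _ hTS z
  rw [LinearMap.comp_apply, LinearMap.comp_apply, hQf_iso u hu.2 z, hz] at e1
  have hcomp : (μ.comp (u : complexBetti A.X 1 →ₗ[ℂ] complexBetti A.X 1)).comp
      (u.symm : complexBetti A.X 1 →ₗ[ℂ] complexBetti A.X 1) = μ := by
    ext v
    simp
  rw [hcomp, hW, hW] at e1
  simpa only [LinearMap.comp_apply, LinearEquiv.coe_coe] using e1

/-- `⋀²u` fixes the `2`-vector of every rational `(1,1)`-class, `u ∈ G_div(X)(ℂ)`.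
[cite: MoonenZarhin1998WeilClasses, §1 (chunk p0002)] [cite: LangeBirkenhake1992, Lemma 1.1.17] -/
theorem sum_smul_cupProduct_apply_apply_eq_of_mem_divisorLefschetzGroup (hn : 1 ≤ A.dim)
    (hh : h ∈ hodgeClassSpan A.dim A.X 1)
    (hnd : ∀ x : complexBetti A.X 1, (∀ y, polarizationPairingOne A.X h (A.dim - 1) x y = 0) → x = 0)
    (hu : u ∈ divisorLefschetzGroup A h)
    {c : complexBetti A.X 2} (hcQ : IsRationalClass c) (hc11 : IsOfHodgeType A.dim A.X 2 1 1 c)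
    (a : ι → ℂ) (x y : ι → complexBetti A.X 1)
    (hc : c = ∑ l, a l • cupProduct (rfl : 1 + 1 = 2) (x l) (y l)) :
    ∑ l, a l • cupProduct (rfl : 1 + 1 = 2) (u (x l)) (u (y l)) =
      ∑ l, a l • cupProduct (rfl : 1 + 1 = 2) (x l) (y l) :=
  sum_smul_cupProduct_apply_apply_eq_of_forall_dual u a x y fun μ ↦
    apply_contraction_eq_of_mem_divisorLefschetzGroup hn hh hnd hu hcQ hc11 a x y hc μ

end Contraction

/-- **«`G_div(X)` leaves invariant all divisor classes in `H²(X, ℚ) = ⋀²V`», PROVED on the carrier**: for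
`h ∈ B¹(A) ⊗ ℂ` with `Q_h` non-degenerate, `u ∈ divisorLefschetzGroup A h` and every rational `(1,1)`-class
`c ∈ H²(A(ℂ); ℂ)`, `⋀²u c = c`. [cite: MoonenZarhin1998WeilClasses, §1 (chunk p0002 L72–L76)]
[cite: Milne1999LefschetzClasses, Thm. 4.4 (proof, p. 659)] [cite: LangeBirkenhake1992, Lemma 1.1.17 and Exercise 1.1.6 (7)] -/
theorem exteriorPullback_two_eq_self_of_mem_divisorLefschetzGroup (hh : h ∈ hodgeClassSpan A.dim A.X 1)
    (hnd : ∀ x : complexBetti A.X 1, (∀ y, polarizationPairingOne A.X h (A.dim - 1) x y = 0) → x = 0)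
    (hu : u ∈ divisorLefschetzGroup A h)
    {c : complexBetti A.X 2} (hcQ : IsRationalClass c) (hc11 : IsOfHodgeType A.dim A.X 2 1 1 c) :
    exteriorPullback (AbelianVariety.hasExteriorCohomologyH1_complexPoints A)
      (u : complexBetti A.X 1 →ₗ[ℂ] complexBetti A.X 1) 2 c = c := by
  rcases Nat.eq_zero_or_pos A.dim with hA | hn
  · haveI : Subsingleton (complexBetti A.X 2) :=
      abelianVarietyCohomologyExteriorH1_holds.subsingleton_of_lt A (by omega)
    exact Subsingleton.elim _ _
  have hmem : c ∈ Submodule.span ℂ (Set.range (cupPowOne ℂ (ComplexPoints A.X) 2)) := by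
    rw [abelianVarietyCohomologyExteriorH1_holds.span_range_cupPowOne A 2]
    exact Submodule.mem_top
  obtain ⟨f, hf⟩ := Finsupp.mem_span_range_iff_exists_finsupp.1 hmem
  have hc : c = ∑ l : f.support, f l • cupProduct (rfl : 1 + 1 = 2)
      ((l : Fin 2 → complexBetti A.X 1) 0) ((l : Fin 2 → complexBetti A.X 1) 1) := by
    rw [← hf, Finsupp.sum, ← Finset.sum_coe_sort]
    refine Finset.sum_congr rfl fun l _ ↦ ?_
    rw [cupPowOne_succ, cupPowOne_one]
    rfl
  rw [hc, map_sum]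
  simp_rw [map_smul, Milne1999.exteriorPullback_cupProduct_one_one, LinearEquiv.coe_coe]
  exact sum_smul_cupProduct_apply_apply_eq_of_mem_divisorLefschetzGroup hn hh hnd hu hcQ hc11 _ _ _ hc

/-- `⋀u` fixes every divisor monomial (`⋀•u` is multiplicative). [cite: MoonenZarhin1998WeilClasses, §1 Lemma (3)]
[cite: HatcherAT2002, §3.2 Prop. 3.10] -/
private theorem exteriorPullback_eq_self_of_mem_divisorMonomials (hh : h ∈ hodgeClassSpan A.dim A.X 1)
    (hnd : ∀ x : complexBetti A.X 1, (∀ y, polarizationPairingOne A.X h (A.dim - 1) x y = 0) → x = 0)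
    (hu : u ∈ divisorLefschetzGroup A h) :
    ∀ (p : ℕ), ∀ c ∈ divisorMonomials A.X A.dim p,
      exteriorPullback (AbelianVariety.hasExteriorCohomologyH1_complexPoints A)
        (u : complexBetti A.X 1 →ₗ[ℂ] complexBetti A.X 1) (2 * p) c = c
  | 0, c, hc => by
    rw [mem_divisorMonomials_zero.1 hc]
    exact exteriorPullback_one _ _
  | p + 1, c, hc => by
    obtain ⟨a, ha, b, hbQ, hb11, rfl⟩ := mem_divisorMonomials_succ.1 hc
    rw [exteriorPullback_cupProduct, exteriorPullback_eq_self_of_mem_divisorMonomials hh hnd hu p a ha,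
      exteriorPullback_two_eq_self_of_mem_divisorLefschetzGroup hh hnd hu hbQ hb11]

/-- **`G_div(X)(ℂ)` fixes all divisor classes of all degrees: `⋀^{2p}u` is the identity on
`D^p(A) ⊗ ℂ = divisorClassesSpan A.X (dim A) p`** (`h ∈ B¹(A) ⊗ ℂ`, `Q_h` non-degenerate) — the inclusion
«`𝒟^•(X) ⊆ (⊕ᵢ ⋀ⁱ V_X)^{G_div(X)}`» of Lemma (3). [cite: MoonenZarhin1998WeilClasses, §1 Lemma (3) and chunk p0002]
[cite: Milne1999LefschetzClasses, Thm. 4.4 (proof, p. 659)] [cite: HatcherAT2002, §3.2 Prop. 3.10] -/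
theorem exteriorPullback_eq_self_of_mem_divisorClassesSpan_of_mem_divisorLefschetzGroup
    (hh : h ∈ hodgeClassSpan A.dim A.X 1)
    (hnd : ∀ x : complexBetti A.X 1, (∀ y, polarizationPairingOne A.X h (A.dim - 1) x y = 0) → x = 0)
    (hu : u ∈ divisorLefschetzGroup A h) (p : ℕ)
    {c : complexBetti A.X (2 * p)} (hc : c ∈ divisorClassesSpan A.X A.dim p) :
    exteriorPullback (AbelianVariety.hasExteriorCohomologyH1_complexPoints A)
      (u : complexBetti A.X 1 →ₗ[ℂ] complexBetti A.X 1) (2 * p) c = c := by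
  induction hc using Submodule.span_induction with
  | mem x hx => exact exteriorPullback_eq_self_of_mem_divisorMonomials hh hnd hu p x hx
  | zero => exact map_zero _
  | add x y _ _ hx hy => rw [map_add, hx, hy]
  | smul r x _ hx => rw [map_smul, hx]

/-- **`G_div(X)(ℂ) ≤ SL(H¹(A(ℂ); ℂ))`: `det u = 1`** when `h` is moreover rational of type `(1,1)` with
`h^{dim A} ≠ 0` (e.g. `s · h` Kähler, `IsKaehlerClass.cupPowTwo_ne_zero`): `⋀²u` fixes `h`, so `⋀u` fixes
`h^{dim A}`, on which it is `det u`. [cite: MoonenZarhin1998WeilClasses, §1 («G_div(X) ⊆ SP(V, φ)»; chunk p0002)]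
[cite: LangeBirkenhake1992, Lemma 1.1.17 and Exercise 1.1.6 (7)–(8)] -/
theorem det_eq_one_of_mem_divisorLefschetzGroup (hh : h ∈ hodgeClassSpan A.dim A.X 1)
    (hnd : ∀ x : complexBetti A.X 1, (∀ y, polarizationPairingOne A.X h (A.dim - 1) x y = 0) → x = 0)
    (hQ : IsRationalClass h) (h11 : IsOfHodgeType A.dim A.X 2 1 1 h) (hpow : cupPowTwo h A.dim ≠ 0)
    (hu : u ∈ divisorLefschetzGroup A h) :
    LinearMap.det (u : complexBetti A.X 1 →ₗ[ℂ] complexBetti A.X 1) = 1 := by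
  haveI : Module.Finite ℂ (complexBetti A.X 1) := abelianVarietyCohomologyExteriorH1_holds.finite_one A
  have hΛ := AbelianVariety.hasExteriorCohomologyH1_complexPoints A
  have hU2 := exteriorPullback_two_eq_self_of_mem_divisorLefschetzGroup hh hnd hu hQ h11
  have e := Milne1999.exteriorPullback_cupPowTwo hΛ hU2 A.dim
  rw [Milne1999.exteriorPullback_top hΛ _ (AbelianVariety.finrank_complexBetti_one A)] at e
  exact smul_left_injective ℂ hpow (e.trans (one_smul ℂ _).symm)

/-! ### Polarization-class spellings (`h` rational, of type `(1,1)`, hard Lefschetz) -/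

/-- A rational `(1,1)`-class lies in `B¹(A) ⊗ ℂ`. [cite: VoisinHodgeI2002, §7.1.2 and §11.3.2] -/
private theorem mem_hodgeClassSpan_of_isRationalClass (hQ : IsRationalClass h)
    (h11 : IsOfHodgeType A.dim A.X 2 1 1 h) : h ∈ hodgeClassSpan A.dim A.X 1 :=
  Submodule.subset_span
    (show h ∈ {c : complexBetti A.X (2 * 1) | IsRationalClass c ∧ IsOfHodgeType A.dim A.X (2 * 1) 1 1 c}
      from ⟨hQ, h11⟩)

/-- **«`G_div(X)` leaves invariant all divisor classes», for a polarization class** (`dim A ≥ 1`, `h`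
rational of type `(1,1)` with the hard Lefschetz property): `⋀^{2p}u c = c` for `u ∈ divisorLefschetzGroup A h`
and `c ∈ divisorClassesSpan A.X (dim A) p`. [cite: MoonenZarhin1998WeilClasses, §1 (chunk p0002 L72–L76), Lemma (3)]
[cite: Milne1999LefschetzClasses, Thm. 4.4 (proof, p. 659)] -/
theorem exteriorPullback_eq_self_of_mem_divisorClassesSpan_of_mem_divisorLefschetzGroup' (h1 : 1 ≤ A.dim)
    (hQ : IsRationalClass h) (h11 : IsOfHodgeType A.dim A.X 2 1 1 h) (hHL : HasHardLefschetzProperty h A.dim)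
    (hu : u ∈ divisorLefschetzGroup A h) (p : ℕ)
    {c : complexBetti A.X (2 * p)} (hc : c ∈ divisorClassesSpan A.X A.dim p) :
    exteriorPullback (AbelianVariety.hasExteriorCohomologyH1_complexPoints A)
      (u : complexBetti A.X 1 →ₗ[ℂ] complexBetti A.X 1) (2 * p) c = c :=
  exteriorPullback_eq_self_of_mem_divisorClassesSpan_of_mem_divisorLefschetzGroup
    (mem_hodgeClassSpan_of_isRationalClass hQ h11)
    (fun _ hx ↦ Milne1999.eq_zero_of_forall_polarizationPairingOne_eq_zero_of_hasHardLefschetzProperty h1 hHL hx)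
    hu p hc


/-! ## Part 3. Lemma (3) «`End(V_X)^{G_div(X)} = B`» and Lemma (1) «`Z(G_div(X)) = U_{K_B}`» for the
print's group: the inclusions that hold on the carrier -/

/-- **Lemma (3), first clause, `⊆` up to `B ⊆ End⁰(X)`: `End(V_X)^{G_div(X)(ℂ)} ⊆ End⁰(X) ⊗ ℂ`** — for
`h ∈ B¹(A) ⊗ ℂ`, an endomorphism of `H¹(A(ℂ); ℂ)` commuting with every `u ∈ G_div(X)(ℂ)` commutes with
`Hg(A)(ℂ)|_{H¹} ≤ G_div(X)(ℂ)` and is therefore a `ℂ`-combination of pull-backs (Deligne I 3.4 + Riemann).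
(`⊇ B ⊗ ℂ` is `divisorLefschetzGroup_comm_of_mem_adjoin`; the print's `= B` needs the double commutant.)
[cite: MoonenZarhin1998WeilClasses, §1 Lemma (3) (chunk p0003)] [cite: Deligne1982HodgeCycles, I §3 Prop. 3.4] -/
theorem mem_span_pullbackOne_of_forall_mem_divisorLefschetzGroup_comm (hh : h ∈ hodgeClassSpan A.dim A.X 1)
    (T : Module.End ℂ (complexBetti A.X 1))
    (hT : ∀ u ∈ divisorLefschetzGroup A h, ∀ y : complexBetti A.X 1, T (u y) = u (T y)) :
    T ∈ Submodule.span ℂ (Set.range fun φ : A ⟶ A ↦ pullbackOne A φ) :=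
  Deligne1982.mem_span_complexBetti_map_of_commute_hodgeGroup_of_riemann deligneMilne1982_Thm_6_20_full_holds A
    T fun g hg y ↦ hT (g 1) (hodgeGroupOne_le_divisorLefschetzGroup hh (mem_hodgeGroupOne_iff.2 ⟨g, hg, rfl⟩)) y

/-- **Lemma (1), inclusion `U_{K_B} ⊆ Z(G_div(X))`, on the carrier**: an element of `G_div(X)(ℂ)` whose
underlying endomorphism lies in `B ⊗ ℂ` (the subalgebra generated by `S_λ ⊗ ℂ`) is CENTRAL — it lies in
`B ⊗ ℂ` and commutes with `B ⊗ ℂ`, i.e. in `K_B ⊗ ℂ = Z(B) ⊗ ℂ`, and every element of `G_div(X)(ℂ)`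
centralizes `B ⊗ ℂ`. No hypothesis on `h`. [cite: MoonenZarhin1998WeilClasses, §1 Lemma (1) (chunk p0002)] -/
theorem mem_center_divisorLefschetzGroup_of_coe_mem_adjoin {z : divisorLefschetzGroup A h}
    (hz : ((z : complexBetti A.X 1 ≃ₗ[ℂ] complexBetti A.X 1) : Module.End ℂ (complexBetti A.X 1)) ∈
      Algebra.adjoin ℂ (symmetricPullbackSpan A h : Set (Module.End ℂ (complexBetti A.X 1)))) :
    z ∈ Subgroup.center (divisorLefschetzGroup A h) := by
  rw [Subgroup.mem_center_iff]
  intro g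
  apply Subtype.ext
  rw [Subgroup.coe_mul, Subgroup.coe_mul]
  refine LinearEquiv.ext fun x ↦ ?_
  rw [LinearEquiv.mul_apply, LinearEquiv.mul_apply]
  exact divisorLefschetzGroup_comm_of_mem_adjoin g.2 hz x

/-- **Lemma (1), inclusion `Z(G_div(X)) ⊆ …`, the part that holds on the carrier**: for `h ∈ B¹(A) ⊗ ℂ`,
the underlying endomorphism of a CENTRAL element of `G_div(X)(ℂ)` is a `ℂ`-combination of pull-backs (it
commutes with `Hg(A)(ℂ)|_{H¹} ≤ G_div(X)(ℂ)`; Deligne I 3.4) — so `Z(G_div(X)(ℂ))` sits inside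
`(End⁰(X) ⊗ ℂ) ∩ C(B ⊗ ℂ) ∩ Sp(Q_h)`; the print's sharper `⊆ U_{K_B}` (`K_B = Z(B)`) needs the double
commutant. [cite: MoonenZarhin1998WeilClasses, §1 Lemma (1) (chunk p0002)] [cite: Deligne1982HodgeCycles, I §3 Prop. 3.4] -/
theorem coe_mem_span_pullbackOne_of_mem_center_divisorLefschetzGroup (hh : h ∈ hodgeClassSpan A.dim A.X 1)
    {z : divisorLefschetzGroup A h} (hz : z ∈ Subgroup.center (divisorLefschetzGroup A h)) :
    ((z : complexBetti A.X 1 ≃ₗ[ℂ] complexBetti A.X 1) : Module.End ℂ (complexBetti A.X 1)) ∈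
      Submodule.span ℂ (Set.range fun φ : A ⟶ A ↦ pullbackOne A φ) := by
  refine mem_span_pullbackOne_of_forall_mem_divisorLefschetzGroup_comm hh _ fun u hu y ↦ ?_
  have e := Subgroup.mem_center_iff.1 hz ⟨u, hu⟩
  have e' := congrArg (fun w : divisorLefschetzGroup A h ↦ (w : complexBetti A.X 1 ≃ₗ[ℂ] complexBetti A.X 1) y) e
  simpa only [Subgroup.coe_mul, LinearEquiv.mul_apply, LinearEquiv.coe_coe] using e'.symm


end Literature.AlgebraicGeometry.HodgeTheory

end
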